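import Literature.Probability.Percolation.SlabRSWGluingFactOne
import Literature.Probability.Percolation.SlabRSWGluingFactTwo
import Literature.Probability.Percolation.SlabGluingHighProb
import HarnessLib

/-!
# Newman–Tassion–Wu 2017, Theorem 3.7 in the HIGH-PROBABILITY regime, general position, from a
# located-gadget supply: `P[C̄ ⟷^{R̄} 𝒩(Γ̄, ρ)] ≥ 1 - δ ⟹ P[C ⟷^R A] ≥ 1 - η`, `δ` uniform

Topic: `Literature/Probability/Percolation`. Third file of Layer 1b of the port of §3 of
Newman–Tassion–Wu (CPAM 70 (2017); arXiv:1512.09107). Printed statement (Thm. 3.7 with the first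
part of its proof, pp. 9–10): "There exists `h₀ ∈ 𝓗` such that … `P_p[C ⟷^R A] ≥ h₀(P_p[C ⟷^R 𝒩(Γ̄, r)])`
… we prove that for some `δ > 0`, there is an `h₁ : [0,1] → [0,1]` … strictly increasing on `[1-δ,1]`,
and with `h₁(1) = 1`".  In `ε-δ` form and uniformly in the geometry: for every `η > 0` there is
`δ > 0`, depending only on `k`, the radii and the parameter window `[ε, 1-ε]`, with
`P[C̄ ⟷^{R̄} 𝒩(Γ̄, ρ)] ≥ 1 - δ ⟹ P[C ⟷^R A] ≥ 1 - η`.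

This file assembles that statement from the three pieces already in the tree: FACT 1 in general
position (`NTW17.fact1`, for `C` at sup-distance `> ρ` from `S`), the probabilistic half of FACT 2
(`NTW17.fact2_of_gadgets`), and the bookkeeping `NTW17.exists_delta_of_facts` — MODULO the geometric
half of Fact 2, taken as a hypothesis in final form: a located gadget (`NTW17.GadgetAt`, box radius
`r`) at every point of `U(ω)` (`GlueData.Uset`) for every lattice configuration of `𝒳_ρ`.  (NTW: the
three-step construction of `ω^{(z)}`, p. 10; the tree has it at the FIRST contact point in rectangle
geometries — `exists_surgery_far`, `exists_surgery_ext`, `exists_directGlue_A/_C` — and what remains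
is to run it at an arbitrary point of `U(ω)`.)

* `NTW17.evNear_subset_evAB`, `measurableSet_evNear`, `diff_evCA_subset_evXn`.
* **`NTW17.glue_highProb_of_gadgets`** — ∀ k ρ r ε η, ∃ δ > 0, for every `GlueData` `Q` with `C` far
  from `S`, every `p ∈ [ε, 1-ε]` (`0 < ε`), if located gadgets exist at all points of `U(ω)` then
  `P_p[evNear ρ] ≥ 1 - δ ⟹ P_p[evCA] ≥ 1 - η`.

## Sources

* C. M. Newman, V. Tassion, W. Wu, *Critical percolation and the minimal spanning tree in
  slabs*, Comm. Pure Appl. Math. 70 (2017) 2084–2120, arXiv:1512.09107: §3.2, Theorem 3.7 and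
  the first part of its proof (Facts 1–2, `h₁`; pp. 9–10) [NewmanTassionWu2017].
-/

noncomputable section

namespace Literature.Probability.Percolation

open MeasureTheory LatticeModels SimpleGraph

namespace NTW17

variable {k : ℕ}

namespace GlueData

variable {Q : GlueData} {ρ : ℕ}

/-- `C̄ ⟷^{R̄} 𝒩(Γ̄, ρ)` presupposes that `Γ` exists: `evNear ρ ⊆ evAB`. [cite: NewmanTassionWu2017, §3.2 (Theorem 3.7, 𝒩(Γ̄, r) with Γ = Γ_min^S(A,B))] -/
theorem evNear_subset_evAB : Q.evNear k ρ ⊆ Q.evAB k := by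
  rintro ω ⟨c₀, -, q, -, g, hg, -⟩
  by_contra hA
  have hγ : Q.γ k ω = [] := minPath_eq_nil fun h => hA ((mem_slabConn_iff_exists_isOSAP ω _ _ _).2 h)
  rw [hγ] at hg
  simp at hg

/-- `evNear ρ ∖ evCA ⊆ 𝒳_ρ`. [cite: NewmanTassionWu2017, §3.2 (proof of Theorem 3.7, the event 𝒳)] -/
theorem diff_evCA_subset_evXn : Q.evNear k ρ \ Q.evCA k ⊆ Q.evXn k ρ :=
  fun _ h => ⟨⟨evNear_subset_evAB h.1, h.2⟩, h.1⟩

/-- `C̄ ⟷^{R̄} 𝒩(Γ̄, ρ)` is a local event (determined by the edges inside `R̄`), hence measurable.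
[cite: NewmanTassionWu2017, §3.2 (Theorem 3.7)] -/
theorem measurableSet_evNear : MeasurableSet (Q.evNear k ρ) := by
  refine measurableSet_of_isLocalEvent_holds ⟨(finite_sym2 (slabLift_finite k Q.hRfin)).toFinset, ?_⟩
  rw [Set.Finite.coe_toFinset, determinedBy_iff]
  intro ω ω' h
  refine mem_evNear_congr fun e he => ?_
  have := Set.ext_iff.1 h e
  simpa [Set.mem_inter_iff, he] using this

end GlueData

open GlueData

/-- **NTW 2017, Theorem 3.7, high-probability regime (`ε-δ` form), general position, from located
gadgets.**  For every thickness `k`, radii `ρ, r`, window parameter `ε > 0` and `η > 0` there is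
`δ > 0` such that: for every `GlueData` `Q` whose far set `C` is at sup-distance `> ρ` from `S`, every
`p ∈ [ε, 1-ε]`, if every lattice configuration of `𝒳_ρ` admits a located gadget (box radius `r`) at
every point of `U(ω)`, then `P_p[C̄ ⟷^{R̄} 𝒩(Γ̄, ρ)] ≥ 1 - δ` implies `P_p[C ⟷^R A] ≥ 1 - η`.
The constant `δ` does not depend on `Q` (this uniformity is what Lemma 3.11 and Theorem 3.17 use).
Proof: Fact 1 (`fact1`) and Fact 2 (`fact2_of_gadgets`) with the constants bounded via
`2/min{p,1-p} ≤ 2/ε`, then `exists_delta_of_facts`.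
[cite: NewmanTassionWu2017, Theorem 3.7 (proof, first part: Facts 1–2 and h₁)] -/
theorem glue_highProb_of_gadgets (k ρ r : ℕ) {ε : ℝ} (hε : 0 < ε) {η : ℝ} (hη : 0 < η) :
    ∃ δ : ℝ, 0 < δ ∧ ∀ (Q : GlueData), (∀ c ∈ Q.C, ∀ s ∈ Q.S, c ∉ sqBox s ρ) →
      ∀ (p : unitInterval), ε ≤ (p : ℝ) → (p : ℝ) ≤ 1 - ε →
      (∀ ω : BondConfig (slab 3 k), ω ⊆ (slabGraph 3 k).edgeSet → ω ∈ Q.evXn k ρ →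
        ∀ y ∈ Q.Uset k ρ ω, ∃ ω', GadgetAt Q k r ω ω' y) →
      1 - δ ≤ (bondPercolation (slabGraph 3 k) p).real (Q.evNear k ρ) →
      1 - η ≤ (bondPercolation (slabGraph 3 k) p).real (Q.evCA k) := by
  -- exponents and the constants at the worst parameter of the window
  set a : ℕ := (5 * k + 4) * (2 * (ρ + 1) + 1) ^ 2 with ha
  set s : ℕ := 3 * ((5 * k + 4) * (2 * (2 * r) + 1) ^ 2) with hs
  set M : ℝ := 3 * (2 * (2 * r) + 1) ^ 2 with hM
  set L : ℝ := max 1 (2 / ε) with hL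
  have hL1 : 1 ≤ L := le_max_left _ _
  have hL0 : 0 ≤ L := zero_le_one.trans hL1
  set C₁ : ℝ := L ^ a with hC₁
  set C₂ : ℝ := M * L ^ s with hC₂
  have hC₁1 : 1 ≤ C₁ := one_le_pow₀ hL1
  have hC₂0 : 0 ≤ C₂ := by positivity
  obtain ⟨t, ht8, δ, hδ, H⟩ := exists_delta_of_facts (C₁ := C₁) (C₂ := C₂) hC₁1 hC₂0 hη
  refine ⟨δ, hδ, fun Q hfar p hpε hp1 hgad hN => ?_⟩
  set P := bondPercolation (slabGraph 3 k) p with hP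
  have hp0 : 0 < (p : ℝ) := hε.trans_le hpε
  have hp1' : (p : ℝ) < 1 := by linarith
  -- `λ_p ≤ L`
  have hlam0 : 0 ≤ 2 / min (p : ℝ) (1 - p) := by positivity
  have hlam : 2 / min (p : ℝ) (1 - p) ≤ L := by
    refine le_trans ?_ (le_max_right _ _)
    exact div_le_div_of_nonneg_left (by norm_num) hε (le_min hpε (by linarith))
  -- Fact 1
  have hF1 : P.real ((Q.evNear k ρ \ Q.evCA k) ∩ {ω | (Q.Uset k ρ ω).ncard ≤ t}) ≤
      C₁ ^ t * P.real (Q.evNear k ρ)ᶜ := by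
    have h1 := fact1 (k := k) Q ρ hfar p hp0 hp1' t
    have hmono : P.real ((Q.evNear k ρ \ Q.evCA k) ∩ {ω | (Q.Uset k ρ ω).ncard ≤ t}) ≤
        P.real (Q.evXn k ρ ∩ {ω | (Q.Uset k ρ ω).ncard ≤ t}) :=
      measureReal_mono (Set.inter_subset_inter_left _ diff_evCA_subset_evXn) (measure_ne_top _ _)
    have hconst : (2 / min (p : ℝ) (1 - p)) ^ ((5 * k + 4) * ((2 * (ρ + 1) + 1) ^ 2 * t)) ≤ C₁ ^ t := by
      rw [show (5 * k + 4) * ((2 * (ρ + 1) + 1) ^ 2 * t) = a * t by rw [ha]; ring, pow_mul, hC₁]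
      exact pow_le_pow_left₀ (by positivity) (pow_le_pow_left₀ hlam0 hlam a) t
    calc _ ≤ _ := hmono
      _ ≤ _ := h1
      _ ≤ C₁ ^ t * P.real (Q.evNear k ρ)ᶜ :=
          mul_le_mul_of_nonneg_right hconst measureReal_nonneg
  -- Fact 2 at level `t + 1`
  have hF2 : P.real ((Q.evNear k ρ \ Q.evCA k) ∩ {ω | t < (Q.Uset k ρ ω).ncard}) ≤
      C₂ / ((t : ℝ) - 8) * P.real (Q.evCA k) := by
    have h2 := fact2_of_gadgets (k := k) (Q := Q) (ρ := ρ) (r := r) (Q.Uset k ρ) (fun ω => Uset_finite ω)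
      (fun ω ω' h => Uset_congr h) hgad p hp0 hp1' (t + 1) (by omega)
    have hmono : P.real ((Q.evNear k ρ \ Q.evCA k) ∩ {ω | t < (Q.Uset k ρ ω).ncard}) ≤
        P.real (Q.evXn k ρ ∩ {ω | t + 1 ≤ (Q.Uset k ρ ω).ncard}) :=
      measureReal_mono (Set.inter_subset_inter diff_evCA_subset_evXn fun ω hω => hω) (measure_ne_top _ _)
    have ht8' : (8 : ℝ) < t := by exact_mod_cast ht8
    have hconst : 3 * (2 * (2 * (r : ℝ)) + 1) ^ 2 * (2 / min (p : ℝ) (1 - p)) ^ s / ((t + 1 : ℕ) : ℝ) ≤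
        C₂ / ((t : ℝ) - 8) := by
      have hnum : 3 * (2 * (2 * (r : ℝ)) + 1) ^ 2 * (2 / min (p : ℝ) (1 - p)) ^ s ≤ C₂ := by
        rw [hC₂, hM]
        exact mul_le_mul_of_nonneg_left (pow_le_pow_left₀ hlam0 hlam s) (by positivity)
      have hC₂' : 0 ≤ 3 * (2 * (2 * (r : ℝ)) + 1) ^ 2 * (2 / min (p : ℝ) (1 - p)) ^ s := by positivity
      calc 3 * (2 * (2 * (r : ℝ)) + 1) ^ 2 * (2 / min (p : ℝ) (1 - p)) ^ s / ((t + 1 : ℕ) : ℝ)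
          ≤ C₂ / ((t + 1 : ℕ) : ℝ) := div_le_div_of_nonneg_right hnum (by positivity)
        _ ≤ C₂ / ((t : ℝ) - 8) := by
            apply div_le_div_of_nonneg_left hC₂0 (by linarith)
            push_cast; linarith
    calc _ ≤ _ := hmono
      _ ≤ _ := h2
      _ ≤ C₂ / ((t : ℝ) - 8) * P.real (Q.evCA k) := by
          push_cast at hconst ⊢
          exact mul_le_mul_of_nonneg_right hconst measureReal_nonneg
  exact H P (Q.evNear k ρ) (Q.evCA k) (fun ω => (Q.Uset k ρ ω).ncard) measurableSet_evNear hF1 hF2 hN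


/-- **The same with the ENTRY-CELL statistic `U_ent`** (Fact 1 in the form `fact1_ent`): located
gadgets at every ENTRY CELL of every lattice configuration of `𝒳_ρ` suffice — the form matching the
tree's rectangle gadgets, which are centred at the cell where an open path from `C̄` first comes
within `ρ` of `Γ̄`. [cite: NewmanTassionWu2017, Theorem 3.7 (proof, first part: Facts 1–2 and h₁)] -/
theorem glue_highProb_of_gadgets_ent (k ρ r : ℕ) {ε : ℝ} (hε : 0 < ε) {η : ℝ} (hη : 0 < η) :
    ∃ δ : ℝ, 0 < δ ∧ ∀ (Q : GlueData), (∀ c ∈ Q.C, ∀ s ∈ Q.S, c ∉ sqBox s ρ) →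
      ∀ (p : unitInterval), ε ≤ (p : ℝ) → (p : ℝ) ≤ 1 - ε →
      (∀ ω : BondConfig (slab 3 k), ω ⊆ (slabGraph 3 k).edgeSet → ω ∈ Q.evXn k ρ →
        ∀ y ∈ Q.Uent k ρ ω, ∃ ω', GadgetAt Q k r ω ω' y) →
      1 - δ ≤ (bondPercolation (slabGraph 3 k) p).real (Q.evNear k ρ) →
      1 - η ≤ (bondPercolation (slabGraph 3 k) p).real (Q.evCA k) := by
  -- exponents and the constants at the worst parameter of the window
  set a : ℕ := 5 * k + 4 with ha
  set s : ℕ := 3 * ((5 * k + 4) * (2 * (2 * r) + 1) ^ 2) with hs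
  set M : ℝ := 3 * (2 * (2 * r) + 1) ^ 2 with hM
  set L : ℝ := max 1 (2 / ε) with hL
  have hL1 : 1 ≤ L := le_max_left _ _
  have hL0 : 0 ≤ L := zero_le_one.trans hL1
  set C₁ : ℝ := L ^ a with hC₁
  set C₂ : ℝ := M * L ^ s with hC₂
  have hC₁1 : 1 ≤ C₁ := one_le_pow₀ hL1
  have hC₂0 : 0 ≤ C₂ := by positivity
  obtain ⟨t, ht8, δ, hδ, H⟩ := exists_delta_of_facts (C₁ := C₁) (C₂ := C₂) hC₁1 hC₂0 hη
  refine ⟨δ, hδ, fun Q hfar p hpε hp1 hgad hN => ?_⟩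
  set P := bondPercolation (slabGraph 3 k) p with hP
  have hp0 : 0 < (p : ℝ) := hε.trans_le hpε
  have hp1' : (p : ℝ) < 1 := by linarith
  -- `λ_p ≤ L`
  have hlam0 : 0 ≤ 2 / min (p : ℝ) (1 - p) := by positivity
  have hlam : 2 / min (p : ℝ) (1 - p) ≤ L := by
    refine le_trans ?_ (le_max_right _ _)
    exact div_le_div_of_nonneg_left (by norm_num) hε (le_min hpε (by linarith))
  -- Fact 1
  have hF1 : P.real ((Q.evNear k ρ \ Q.evCA k) ∩ {ω | (Q.Uent k ρ ω).ncard ≤ t}) ≤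
      C₁ ^ t * P.real (Q.evNear k ρ)ᶜ := by
    have h1 := fact1_ent (k := k) Q ρ hfar p hp0 hp1' t
    have hmono : P.real ((Q.evNear k ρ \ Q.evCA k) ∩ {ω | (Q.Uent k ρ ω).ncard ≤ t}) ≤
        P.real (Q.evXn k ρ ∩ {ω | (Q.Uent k ρ ω).ncard ≤ t}) :=
      measureReal_mono (Set.inter_subset_inter_left _ diff_evCA_subset_evXn) (measure_ne_top _ _)
    have hconst : (2 / min (p : ℝ) (1 - p)) ^ ((5 * k + 4) * t) ≤ C₁ ^ t := by
      rw [show (5 * k + 4) * t = a * t by rw [ha], pow_mul, hC₁]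
      exact pow_le_pow_left₀ (by positivity) (pow_le_pow_left₀ hlam0 hlam a) t
    calc _ ≤ _ := hmono
      _ ≤ _ := h1
      _ ≤ C₁ ^ t * P.real (Q.evNear k ρ)ᶜ :=
          mul_le_mul_of_nonneg_right hconst measureReal_nonneg
  -- Fact 2 at level `t + 1`
  have hF2 : P.real ((Q.evNear k ρ \ Q.evCA k) ∩ {ω | t < (Q.Uent k ρ ω).ncard}) ≤
      C₂ / ((t : ℝ) - 8) * P.real (Q.evCA k) := by
    have h2 := fact2_of_gadgets (k := k) (Q := Q) (ρ := ρ) (r := r) (Q.Uent k ρ) (fun ω => Uent_finite ω)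
      (fun ω ω' h => Uent_congr h) hgad p hp0 hp1' (t + 1) (by omega)
    have hmono : P.real ((Q.evNear k ρ \ Q.evCA k) ∩ {ω | t < (Q.Uent k ρ ω).ncard}) ≤
        P.real (Q.evXn k ρ ∩ {ω | t + 1 ≤ (Q.Uent k ρ ω).ncard}) :=
      measureReal_mono (Set.inter_subset_inter diff_evCA_subset_evXn fun ω hω => hω) (measure_ne_top _ _)
    have ht8' : (8 : ℝ) < t := by exact_mod_cast ht8
    have hconst : 3 * (2 * (2 * (r : ℝ)) + 1) ^ 2 * (2 / min (p : ℝ) (1 - p)) ^ s / ((t + 1 : ℕ) : ℝ) ≤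
        C₂ / ((t : ℝ) - 8) := by
      have hnum : 3 * (2 * (2 * (r : ℝ)) + 1) ^ 2 * (2 / min (p : ℝ) (1 - p)) ^ s ≤ C₂ := by
        rw [hC₂, hM]
        exact mul_le_mul_of_nonneg_left (pow_le_pow_left₀ hlam0 hlam s) (by positivity)
      have hC₂' : 0 ≤ 3 * (2 * (2 * (r : ℝ)) + 1) ^ 2 * (2 / min (p : ℝ) (1 - p)) ^ s := by positivity
      calc 3 * (2 * (2 * (r : ℝ)) + 1) ^ 2 * (2 / min (p : ℝ) (1 - p)) ^ s / ((t + 1 : ℕ) : ℝ)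
          ≤ C₂ / ((t + 1 : ℕ) : ℝ) := div_le_div_of_nonneg_right hnum (by positivity)
        _ ≤ C₂ / ((t : ℝ) - 8) := by
            apply div_le_div_of_nonneg_left hC₂0 (by linarith)
            push_cast; linarith
    calc _ ≤ _ := hmono
      _ ≤ _ := h2
      _ ≤ C₂ / ((t : ℝ) - 8) * P.real (Q.evCA k) := by
          push_cast at hconst ⊢
          exact mul_le_mul_of_nonneg_right hconst measureReal_nonneg
  exact H P (Q.evNear k ρ) (Q.evCA k) (fun ω => (Q.Uent k ρ ω).ncard) measurableSet_evNear hF1 hF2 hN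

end NTW17

end Literature.Probability.Percolation

end
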